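import Summits.FinalStateConjecture.FinalStateConjecture.Theorems.EIHFluxBalanceInertialRecessionStubRechart3Package
import Summits.FinalStateConjecture.FinalStateConjecture.Theorems.EIHFluxBalanceInertialRecessionStubRechart3Frames
import Summits.FinalStateConjecture.FinalStateConjecture.Theorems.EIHFluxBalanceInertialRecessionRechartCarterReachClock
import Summits.FinalStateConjecture.FinalStateConjecture.Theorems.EIHFluxBalanceInertialRecessionRechartClockCoverage
import Summits.FinalStateConjecture.FinalStateConjecture.Theorems.EIHFluxBalanceInertialRecessionRechartOfut

/-!
# Route EIHFluxBalance — `InertialRecession`, re-charting: the HOLE PACKAGES of the clock charts with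
# their causal data (lab clocks, future orientation, floor-adjusted certified Carter reach)

Helper file for the crux `stmt-FinalStateConjecture-10166`
(`Summit.FinalStateConjecture.FinalStateConjecture.Theses.EIHFluxBalance.InertialRecession`),
stub `stub_rechart` (the transfer P2 of line `sublinear-is-free-clean-window-charges`), part G2.

`clock_hole_packages`: from the data of `stub_rechart` (sub-extremal holes, bounded Lorentz factors,
smooth painted motions, separation, the lab chart with its `C³` deviation decay, `Slaved³`, the
orientation `0 < (Λᵢe₀)⁰` and eventual LAB-TIME CAUSALITY on the guaranteed region) this file produces,
for every hole, the normalised frame (`exists_normalisedFrame'`), the clock chart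
(`clockChart_package`, late after `max τ₀ τT`), the lab clock `θᵢ = T₀ᵢ⁻¹` with its calculus
(…RechartClockCoverage), and the certified Carter reach of the rest chart with a monotone profile
`Rrᵢ → ∞`, `Rrᵢ ≥ r₊ᵢ + 2`, along which the rest chart still converges (…RechartCarterReachClock; the
future orientation of the lab chart on the guaranteed region is `isFutureDirected_mfderiv_of_labTimeCausality`
of …RechartOfut) — exactly the inputs of `clock_transfer_clauses` (…RechartClockTransferClauses) and of
the flat package. [folklore]
-/

noncomputable section

set_option linter.dupNamespace false

open Set Filter Topology Function TopologicalSpace Metric Literature.Geometry.Lorentzian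
open Summit.FinalStateConjecture.FinalStateConjecture.Theorems.SublinearIsFree.Rechart
open scoped Manifold ContDiff ENNReal BigOperators

namespace Summit.FinalStateConjecture.FinalStateConjecture.Theorems

/-- Floor adjustment of a reach profile: `max (R t) c` is monotone, tends to `∞`, is `≥ c`, and
eventually equals `R`. [folklore] -/
theorem floor_profile {R : ℝ → ℝ} (hRm : Monotone R) (hRtop : Tendsto R atTop atTop) (c : ℝ) :
    Monotone (fun t ↦ max (R t) c) ∧ Tendsto (fun t ↦ max (R t) c) atTop atTop ∧
      (∀ t, c ≤ max (R t) c) ∧ ∃ t₀, ∀ t, t₀ ≤ t → max (R t) c = R t := by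
  obtain ⟨t₀, ht₀⟩ := eventually_atTop.mp (hRtop.eventually (eventually_ge_atTop c))
  exact ⟨fun t t' h ↦ max_le_max (hRm h) le_rfl, tendsto_atTop_mono (fun t ↦ le_max_left _ _) hRtop,
    fun t ↦ le_max_right _ _, t₀, fun t ht ↦ max_eq_left (ht₀ t ht)⟩

-- the assembly is long
set_option maxHeartbeats 3200000 in
/-- **The hole packages of the clock charts with their causal data.** See the module docstring.
[folklore] -/
theorem clock_hole_packages (𝓢 : Spacetime 4) {N : ℕ} (M a rin : Fin N → ℝ)
    (Λ : Fin N → ℝ → lorentzGroup) (ξ : Fin N → ℝ → E3) (γ τ₀ : ℝ) (U : Opens E4) (Φ : U → 𝓢.carrier)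
    (hsub : ∀ i, Kerr.IsSubextremal (M i) (a i) ∧ Kerr.rMinus (M i) (a i) < rin i ∧ rin i < Kerr.rPlus (M i) (a i))
    (hγ : ∀ i t, |((Λ i t : E4 ≃L[ℝ] E4) (E4.basisVector 0)) 0| ≤ γ)
    (hsm : ∀ i, ContDiff ℝ ∞ (ξ i) ∧ ContDiff ℝ ∞ (fun t ↦ ((Λ i t : E4 ≃L[ℝ] E4) : E4 →L[ℝ] E4)))
    (hsep : ∀ i j, i ≠ j → Tendsto (fun t ↦ ‖ξ i t - ξ j t‖) atTop atTop)
    (hU : {x : E4 | τ₀ < x 0 ∧ ∀ i, rin i < Kerr.radius (a i)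
      (poincareInv (Λ i (x 0)) (E4.ofTimeSpace (x 0) (ξ i (x 0))) x)} ⊆ (U : Set E4))
    (hΦ : ContMDiff 𝓘(ℝ, E4) (𝓡 4) ∞ Φ)
    (hdev : Tendsto (fun t ↦ 𝓢.deviationCk ⟨U, fun x ↦ Minkowski.bilin +
      ∑ i, (boostedKerrBilin (Λ i (x 0)) (E4.ofTimeSpace (x 0) (ξ i (x 0))) (M i) (a i) x -
        Minkowski.bilin), fun x ↦ x 0, E4.spatialNorm⟩ Φ 3 t) atTop (𝓝 0))
    (Slaved : ∀ i : Fin N, (∀ m : ℕ, 1 ≤ m → m ≤ 3 → Tendsto (fun t ↦ iteratedDeriv m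
        (fun s ↦ ((Λ i s : E4 ≃L[ℝ] E4) (E4.basisVector 0))) t) atTop (𝓝 0)) ∧
      (∀ m : ℕ, m ≤ 2 → Tendsto (fun t ↦ iteratedDeriv m (fun s ↦ deriv (ξ i) s -
        ((((Λ i s : E4 ≃L[ℝ] E4) (E4.basisVector 0)) 0)⁻¹ •
          E4.spatial ((Λ i s : E4 ≃L[ℝ] E4) (E4.basisVector 0)))) t) atTop (𝓝 0)) ∧
      (a i ≠ 0 → ∀ m : ℕ, 1 ≤ m → m ≤ 3 → Tendsto (fun t ↦ iteratedDeriv m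
        (fun s ↦ ((Λ i s : E4 ≃L[ℝ] E4) (E4.basisVector 3))) t) atTop (𝓝 0)))
    (hpos : ∀ i t, 0 < ((Λ i t : E4 ≃L[ℝ] E4) (E4.basisVector 0)) 0)
    {τT : ℝ} (hT : ∀ x y : U,
      (τT < x.1 0 ∧ ∀ i, rin i < Kerr.radius (a i)
        (poincareInv (Λ i (x.1 0)) (E4.ofTimeSpace (x.1 0) (ξ i (x.1 0))) x.1)) →
      (τT < y.1 0 ∧ ∀ i, rin i < Kerr.radius (a i)
        (poincareInv (Λ i (y.1 0)) (E4.ofTimeSpace (y.1 0) (ξ i (y.1 0))) y.1)) →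
      Φ y ∈ 𝓢.metric.causalFuture 𝓢.timeOrientation {Φ x} → x.1 0 ≤ y.1 0) :
    ∃ (Λt : Fin N → ℝ → lorentzGroup) (T₀ : Fin N → ℝ → ℝ) (C A : Fin N → E4 → E4)
      (hAU : ∀ i, ∀ z ∈ boostedKerrExterior 1 0 (M i) (a i), A i z ∈ U)
      (θ Rr : Fin N → ℝ → ℝ) (Sr : Fin N → ℝ),
      -- frames
      (∀ i, ContDiff ℝ ∞ (fun t ↦ ((Λt i t : E4 ≃L[ℝ] E4) : E4 →L[ℝ] E4))) ∧
      (∀ i t, (Λt i t : E4 ≃L[ℝ] E4) (E4.basisVector 0) = (Λ i t : E4 ≃L[ℝ] E4) (E4.basisVector 0)) ∧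
      (∀ i m, 1 ≤ m → m ≤ 3 → Tendsto (fun t ↦ iteratedDeriv m
        (fun s ↦ ((Λt i s : E4 ≃L[ℝ] E4) : E4 →L[ℝ] E4)) t) atTop (𝓝 0)) ∧
      (∀ j t x, boostedKerrBilin (Λt j t) (E4.ofTimeSpace t (ξ j t)) (M j) (a j) x =
        boostedKerrBilin (Λ j t) (E4.ofTimeSpace t (ξ j t)) (M j) (a j) x) ∧
      (∀ j t x, Kerr.radius (a j) (poincareInv (Λt j t) (E4.ofTimeSpace t (ξ j t)) x) =
        Kerr.radius (a j) (poincareInv (Λ j t) (E4.ofTimeSpace t (ξ j t)) x)) ∧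
      -- clocks
      (∀ i, ContDiff ℝ ∞ (T₀ i)) ∧ (∀ i τ, HasDerivAt (T₀ i) (frameVel (Λt i (T₀ i τ)) 0) τ) ∧
      (∀ i σ τ, σ ≤ τ → τ - σ ≤ T₀ i τ - T₀ i σ) ∧
      (∀ i σ τ, σ ≤ τ → T₀ i τ - T₀ i σ ≤ max γ 1 * (τ - σ)) ∧ (∀ i, Tendsto (T₀ i) atTop atTop) ∧
      -- charts
      (∀ i y, A i y = honestChart (Λt i) (ξ i) (T₀ i) (C i y)) ∧ (∀ i, ContDiff ℝ ∞ (A i)) ∧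
      (∀ i, IsOpenEmbedding (A i)) ∧ (∀ i y, max τ₀ τT < A i y 0) ∧
      (∀ i y, |A i y 0 - T₀ i (C i y 0)| ≤ 4 * max γ 1 * ‖E4.spatial (C i y)‖) ∧
      (∀ i y, ‖E4.spatial (C i y)‖ ≤ ‖E4.spatial y‖) ∧ (∀ i y, y 0 ≤ C i y 0) ∧
      (∀ i y, ‖E4.spatial (A i y) - ξ i (A i y 0)‖ ≤ (4 * max γ 1 + (4 * max γ 1) ^ 2) * ‖E4.spatial (C i y)‖) ∧
      (∀ i, ∀ y ∈ boostedKerrExterior 1 0 (M i) (a i), ∀ j, Kerr.rPlus (M j) (a j) <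
        Kerr.radius (a j) (poincareInv (Λ j (A i y 0)) (E4.ofTimeSpace (A i y 0) (ξ j (A i y 0))) (A i y))) ∧
      (∀ i (K : ℝ), ∃ τK : ℝ, ∀ y : E4, τK ≤ y 0 → ‖E4.spatial y‖ ≤ K →
        A i =ᶠ[𝓝 y] honestChart (Λt i) (ξ i) (T₀ i)) ∧
      (∀ i (R : ℝ), Tendsto (fun τ ↦ 𝓢.truncDeviationCk (boostedKerrBackground 1 0 (M i) (a i))
        (fun z : boostedKerrExterior 1 0 (M i) (a i) ↦ Φ ⟨A i z.1, hAU i z.1 z.2⟩) 2 R τ) atTop (𝓝 0)) ∧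
      -- lab clocks
      (∀ i τ, θ i (T₀ i τ) = τ) ∧ (∀ i t, T₀ i (θ i t) = t) ∧ (∀ i, Monotone (θ i)) ∧
      (∀ i t t', t' ≤ t → θ i t - θ i t' ≤ t - t') ∧ (∀ i, Continuous (θ i)) ∧
      (∀ i, Tendsto (θ i) atTop atTop) ∧
      (∀ i t, HasDerivAt (fun t ↦ t - θ i t) (1 - (((Λt i t : E4 ≃L[ℝ] E4) (E4.basisVector 0)) 0)⁻¹) t) ∧
      -- certified reach
      (∀ i, Monotone (Rr i)) ∧ (∀ i, Tendsto (Rr i) atTop atTop) ∧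
      (∀ i t, Kerr.rPlus (M i) (a i) + 2 ≤ Rr i t) ∧
      (∀ i, Tendsto (fun τ ↦ 𝓢.truncDeviationCk (boostedKerrBackground 1 0 (M i) (a i))
        (fun z : boostedKerrExterior 1 0 (M i) (a i) ↦ Φ ⟨A i z.1, hAU i z.1 z.2⟩) 2 (Rr i τ) τ)
          atTop (𝓝 0)) ∧
      (∀ i (z : boostedKerrExterior 1 0 (M i) (a i)) (τ₁ : ℝ), Sr i ≤ z.1 0 → z.1 0 ≤ τ₁ →
        Kerr.rPlus (M i) (a i) + 1 ≤ Kerr.radius (a i) z.1 → Kerr.radius (a i) z.1 ≤ Rr i (z.1 0) →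
        Φ ⟨A i z.1, hAU i z.1 z.2⟩ ∈ 𝓢.metric.causalPast 𝓢.timeOrientation
          ((fun z : boostedKerrExterior 1 0 (M i) (a i) ↦ Φ ⟨A i z.1, hAU i z.1 z.2⟩) ''
            (boostedKerrBackground 1 0 (M i) (a i)).truncTimeSlab (Rr i τ₁) τ₁)) := by
  -- Lorentz factor floor
  set γ' : ℝ := max γ 1 with hγ'
  have hγ1 : 1 ≤ γ' := le_max_right _ _
  have hγ'b : ∀ i t, |((Λ i t : E4 ≃L[ℝ] E4) (E4.basisVector 0)) 0| ≤ γ' :=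
    fun i t ↦ (hγ i t).trans (le_max_left _ _)
  -- normalised frames (as in `rechart_analytic_package`)
  have hnorm : ∀ i, ∃ Λ' : ℝ → lorentzGroup, ContDiff ℝ ∞ (fun t ↦ ((Λ' t : E4 ≃L[ℝ] E4) : E4 →L[ℝ] E4)) ∧
      (∀ t, (Λ' t : E4 ≃L[ℝ] E4) (E4.basisVector 0) = (Λ i t : E4 ≃L[ℝ] E4) (E4.basisVector 0)) ∧
      (∀ m, 1 ≤ m → m ≤ 3 → Tendsto (fun t ↦ iteratedDeriv m
        (fun s ↦ ((Λ' s : E4 ≃L[ℝ] E4) : E4 →L[ℝ] E4)) t) atTop (𝓝 0)) ∧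
      (∀ t c x, boostedKerrBilin (Λ i t) c (M i) (a i) x = boostedKerrBilin (Λ' t) c (M i) (a i) x) ∧
      (∀ t c x, Kerr.radius (a i) (poincareInv (Λ i t) c x) = Kerr.radius (a i) (poincareInv (Λ' t) c x)) :=
    fun i ↦ exists_normalisedFrame' (Λ i) γ' (M i) (a i) (hsm i).2 (hγ'b i) (hpos i) (Slaved i).1 (Slaved i).2.2
  choose Λt hΛt he₀ hdec hbil' hrad' using hnorm
  have hbil : ∀ j t x, boostedKerrBilin (Λt j t) (E4.ofTimeSpace t (ξ j t)) (M j) (a j) x =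
      boostedKerrBilin (Λ j t) (E4.ofTimeSpace t (ξ j t)) (M j) (a j) x := fun j t x ↦ (hbil' j t _ x).symm
  have hrad : ∀ j t x, Kerr.radius (a j) (poincareInv (Λt j t) (E4.ofTimeSpace t (ξ j t)) x) =
      Kerr.radius (a j) (poincareInv (Λ j t) (E4.ofTimeSpace t (ξ j t)) x) := fun j t x ↦ (hrad' j t _ x).symm
  have huγ : ∀ j t, |((Λt j t : E4 ≃L[ℝ] E4) (E4.basisVector 0)) 0| ≤ γ' := fun j t ↦ by
    rw [he₀]; exact hγ'b j t
  have hpos' : ∀ j t, 0 < ((Λt j t : E4 ≃L[ℝ] E4) (E4.basisVector 0)) 0 := fun j t ↦ by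
    rw [he₀]; exact hpos j t
  have hmis : ∀ j, ∀ m : ℕ, m ≤ 2 → Tendsto (fun t ↦ iteratedDeriv m (fun s ↦ deriv (ξ j) s -
      ((((Λt j s : E4 ≃L[ℝ] E4) (E4.basisVector 0)) 0)⁻¹ •
        E4.spatial ((Λt j s : E4 ≃L[ℝ] E4) (E4.basisVector 0)))) t) atTop (𝓝 0) := by
    intro j m hm
    have h := (Slaved j).2.1 m hm
    simp only [he₀]
    exact h
  have hξ : ∀ j, ContDiff ℝ ∞ (ξ j) := fun j ↦ (hsm j).1
  have hΛ : ∀ j, ContDiff ℝ ∞ (fun t ↦ ((Λ j t : E4 ≃L[ℝ] E4) : E4 →L[ℝ] E4)) := fun j ↦ (hsm j).2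
  -- the lab background and the summands
  set Bf : ModelBackground := ⟨U, fun x ↦ Minkowski.bilin +
      ∑ i, (boostedKerrBilin (Λ i (x 0)) (E4.ofTimeSpace (x 0) (ξ i (x 0))) (M i) (a i) x -
        Minkowski.bilin), fun x ↦ x 0, E4.spatialNorm⟩ with hBf
  set H : Fin N → E4 → E4 →L[ℝ] E4 →L[ℝ] ℝ := fun j z ↦ boostedKerrBilin (Λ j (z 0))
    (E4.ofTimeSpace (z 0) (ξ j (z 0))) (M j) (a j) z - Minkowski.bilin with hH
  have hrPlus : ∀ i, 0 < Kerr.rPlus (M i) (a i) := fun i ↦ by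
    have h1 : 0 < M i := (abs_nonneg (a i)).trans_lt (hsub i).1
    unfold Kerr.rPlus
    linarith [Real.sqrt_nonneg (M i ^ 2 - a i ^ 2)]
  -- the hole packages, late after `Tl := max τ₀ τT`
  set Tl : ℝ := max τ₀ τT with hTl
  have hpack := fun i : Fin N ↦ clockChart_package 𝓢 i M a Λ ξ Λt hbil hrad (H := H) (fun j z ↦ rfl)
    (Bb := Bf.bilin) (fun z ↦ rfl) hΛ hξ hΛt hdec hγ1 huγ hpos' hmis (fun j hj ↦ hsep i j (Ne.symm hj)) U Φ hΦ
    hdev (hrin := fun j ↦ (hsub j).2.2) hU (hrPlus i) Tl (le_max_left _ _)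
  choose T₀ ρ' C A hAU hP using hpack
  -- the clauses used below
  have hQ : ∀ i, ContDiff ℝ ∞ (T₀ i) ∧ (∀ τ, HasDerivAt (T₀ i) (frameVel (Λt i (T₀ i τ)) 0) τ) ∧
      (∀ σ τ, σ ≤ τ → τ - σ ≤ T₀ i τ - T₀ i σ ∧ T₀ i τ - T₀ i σ ≤ γ' * (τ - σ)) ∧
      (∀ y, y 0 ≤ C i y 0) ∧ (∀ y, ‖E4.spatial (C i y)‖ ≤ ‖E4.spatial y‖) ∧
      (∀ y, A i y = honestChart (Λt i) (ξ i) (T₀ i) (C i y)) ∧ ContDiff ℝ ∞ (A i) ∧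
      IsOpenEmbedding (A i) ∧ (∀ y, Tl < A i y 0) ∧
      (∀ y, |A i y 0 - T₀ i (C i y 0)| ≤ 4 * γ' * ‖E4.spatial (C i y)‖) ∧
      (∀ y, ‖E4.spatial (A i y) - ξ i (A i y 0)‖ ≤ (4 * γ' + (4 * γ') ^ 2) * ‖E4.spatial (C i y)‖) ∧
      (∀ y ∈ boostedKerrExterior 1 0 (M i) (a i), ∀ j, Kerr.rPlus (M j) (a j) <
        Kerr.radius (a j) (poincareInv (Λ j (A i y 0)) (E4.ofTimeSpace (A i y 0) (ξ j (A i y 0))) (A i y))) ∧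
      (∀ K : ℝ, ∃ τK : ℝ, ∀ y : E4, τK ≤ y 0 → ‖E4.spatial y‖ ≤ K →
        A i =ᶠ[𝓝 y] honestChart (Λt i) (ξ i) (T₀ i)) ∧
      (∀ R : ℝ, Tendsto (fun τ ↦ 𝓢.truncDeviationCk (boostedKerrBackground 1 0 (M i) (a i))
        (fun z : boostedKerrExterior 1 0 (M i) (a i) ↦ Φ ⟨A i z.1, hAU i z.1 z.2⟩) 2 R τ) atTop (𝓝 0)) := by
    intro i
    obtain ⟨h1, h2, h3, -, -, -, -, h8, -, h10, -, h12, h13, h14, h15, h16, h17, h18, -, h20, h21⟩ := hP i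
    exact ⟨h1, h2, h3, h8, h10, h12, h13, h14, h15, h16, h17, h18, h20, h21 _ (fun _ ↦ rfl)⟩
  have hT₀c : ∀ i, ContDiff ℝ ∞ (T₀ i) := fun i ↦ (hQ i).1
  have hclock : ∀ i τ, HasDerivAt (T₀ i) (frameVel (Λt i (T₀ i τ)) 0) τ := fun i ↦ (hQ i).2.1
  have hT₀lo : ∀ i σ τ, σ ≤ τ → τ - σ ≤ T₀ i τ - T₀ i σ := fun i σ τ h ↦ ((hQ i).2.2.1 σ τ h).1
  have hT₀hi : ∀ i σ τ, σ ≤ τ → T₀ i τ - T₀ i σ ≤ γ' * (τ - σ) := fun i σ τ h ↦ ((hQ i).2.2.1 σ τ h).2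
  have hC0 : ∀ i y, y 0 ≤ C i y 0 := fun i ↦ (hQ i).2.2.2.1
  have hCle : ∀ i y, ‖E4.spatial (C i y)‖ ≤ ‖E4.spatial y‖ := fun i ↦ (hQ i).2.2.2.2.1
  have hAC : ∀ i y, A i y = honestChart (Λt i) (ξ i) (T₀ i) (C i y) := fun i ↦ (hQ i).2.2.2.2.2.1
  have hAc : ∀ i, ContDiff ℝ ∞ (A i) := fun i ↦ (hQ i).2.2.2.2.2.2.1
  have hAemb : ∀ i, IsOpenEmbedding (A i) := fun i ↦ (hQ i).2.2.2.2.2.2.2.1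
  have hlate : ∀ i y, Tl < A i y 0 := fun i ↦ (hQ i).2.2.2.2.2.2.2.2.1
  have hwin : ∀ i y, |A i y 0 - T₀ i (C i y 0)| ≤ 4 * γ' * ‖E4.spatial (C i y)‖ :=
    fun i ↦ (hQ i).2.2.2.2.2.2.2.2.2.1
  have hoff : ∀ i y, ‖E4.spatial (A i y) - ξ i (A i y 0)‖ ≤ (4 * γ' + (4 * γ') ^ 2) * ‖E4.spatial (C i y)‖ :=
    fun i ↦ (hQ i).2.2.2.2.2.2.2.2.2.2.1
  have hradii : ∀ i, ∀ y ∈ boostedKerrExterior 1 0 (M i) (a i), ∀ j, Kerr.rPlus (M j) (a j) <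
      Kerr.radius (a j) (poincareInv (Λ j (A i y 0)) (E4.ofTimeSpace (A i y 0) (ξ j (A i y 0))) (A i y)) :=
    fun i ↦ (hQ i).2.2.2.2.2.2.2.2.2.2.2.1
  have hhon : ∀ i (K : ℝ), ∃ τK : ℝ, ∀ y : E4, τK ≤ y 0 → ‖E4.spatial y‖ ≤ K →
      A i =ᶠ[𝓝 y] honestChart (Λt i) (ξ i) (T₀ i) := fun i ↦ (hQ i).2.2.2.2.2.2.2.2.2.2.2.2.1
  have hconv : ∀ i (R : ℝ), Tendsto (fun τ ↦ 𝓢.truncDeviationCk (boostedKerrBackground 1 0 (M i) (a i))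
      (fun z : boostedKerrExterior 1 0 (M i) (a i) ↦ Φ ⟨A i z.1, hAU i z.1 z.2⟩) 2 R τ) atTop (𝓝 0) :=
    fun i ↦ (hQ i).2.2.2.2.2.2.2.2.2.2.2.2.2
  -- clocks tend to infinity
  have htop : ∀ i, Tendsto (T₀ i) atTop atTop := fun i ↦ by
    refine tendsto_atTop_mono' atTop ?_ (tendsto_atTop_add_const_right atTop (T₀ i 0) tendsto_id)
    filter_upwards [eventually_ge_atTop 0] with τ hτ
    have := hT₀lo i 0 τ hτ
    show τ + T₀ i 0 ≤ T₀ i τ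
    linarith
  -- lab clocks
  choose θ hθ using fun i ↦ exists_labClock_package (Λt i) (T₀ i) (hclock i) (hT₀lo i) (hT₀hi i) (hpos' i)
  -- future orientation of the lab chart on the guaranteed region (lab-time causality)
  set Sg : Set E4 := {z : E4 | Tl < z 0 ∧ ∀ i, rin i < Kerr.radius (a i)
    (poincareInv (Λ i (z 0)) (E4.ofTimeSpace (z 0) (ξ i (z 0))) z)} with hSg
  have hSgo : IsOpen Sg := isOpen_lateGuaranteed_rechart a rin Λ ξ Tl (fun i ↦ (hΛ i).continuous)
    (fun i ↦ (hξ i).continuous)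
  have hSgU : Sg ⊆ (U : Set E4) := fun z hz ↦ hU ⟨(le_max_left _ _).trans_lt hz.1, hz.2⟩
  have hTS : ∀ x y : U, x.1 ∈ Sg → y.1 ∈ Sg →
      Φ y ∈ 𝓢.metric.causalFuture 𝓢.timeOrientation {Φ x} → x.1 0 ≤ y.1 0 := fun x y hx hy h ↦
    hT x y ⟨(le_max_right _ _).trans_lt hx.1, hx.2⟩ ⟨(le_max_right _ _).trans_lt hy.1, hy.2⟩ h
  have hOfut : ∀ x : U, x.1 ∈ Sg → ∀ w : E4, 0 < w 0 →
      𝓢.metric.val (Φ x) (mfderiv 𝓘(ℝ, E4) (𝓡 4) Φ x w) (mfderiv 𝓘(ℝ, E4) (𝓡 4) Φ x w) < 0 →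
        𝓢.timeOrientation.IsFutureDirected (mfderiv 𝓘(ℝ, E4) (𝓡 4) Φ x w) :=
    fun x hx w hw htl ↦ isFutureDirected_mfderiv_of_labTimeCausality hΦ hSgo hSgU hTS x hx hw htl
  have hQA : ∀ i (y : E4) (hy : y ∈ (boostedKerrBackground 1 0 (M i) (a i)).domain),
      (⟨A i y, hAU i y hy⟩ : U).1 ∈ Sg := fun i y hy ↦
    ⟨hlate i y, fun j ↦ (hsub j).2.2.trans (hradii i y hy j)⟩
  -- certified Carter reach of the rest charts
  have hreach0 : ∀ i, ∃ R : ℝ → ℝ, Monotone R ∧ Tendsto R atTop atTop ∧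
      Tendsto (fun τ ↦ 𝓢.truncDeviationCk (boostedKerrBackground 1 0 (M i) (a i))
        (fun z : boostedKerrExterior 1 0 (M i) (a i) ↦ Φ ⟨A i z.1, hAU i z.1 z.2⟩) 2 (R τ) τ) atTop (𝓝 0) ∧
      ∃ S : ℝ, ∀ (y : (boostedKerrBackground 1 0 (M i) (a i)).domain) (τ₁ : ℝ),
        S ≤ (boostedKerrBackground 1 0 (M i) (a i)).time y.1 →
        (boostedKerrBackground 1 0 (M i) (a i)).time y.1 ≤ τ₁ →
        Kerr.rPlus (M i) (a i) + 1 ≤ (boostedKerrBackground 1 0 (M i) (a i)).radius y.1 →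
        (boostedKerrBackground 1 0 (M i) (a i)).radius y.1 ≤ R ((boostedKerrBackground 1 0 (M i) (a i)).time y.1) →
        Φ ⟨A i y.1, hAU i y.1 y.2⟩ ∈ 𝓢.metric.causalPast 𝓢.timeOrientation
          ((fun y : (boostedKerrBackground 1 0 (M i) (a i)).domain ↦ Φ ⟨A i y.1, hAU i y.1 y.2⟩) ''
            (boostedKerrBackground 1 0 (M i) (a i)).truncTimeSlab (R τ₁) τ₁) := by
    intro i
    have hclockd : ∀ τ, deriv (T₀ i) τ = frameVel (Λt i (T₀ i τ)) 0 := fun τ ↦ (hclock i τ).deriv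
    have hdecTilt : Tendsto (fun t ↦ deriv (fun s ↦ frameTilt (Λt i s)) t) atTop (𝓝 0) := by
      have h := tendsto_iteratedDeriv_frameTilt (Λt i) (hΛt i) (hdec i) 1 le_rfl (by norm_num)
      simpa only [iteratedDeriv_one] using h
    obtain ⟨R, hRm, hRtop, -, hconvR, hreach⟩ := exists_carter_reach_clock (hsub i).1 U Φ hΦ (hAc i) (hAU i)
      (fun x : U ↦ x.1 ∈ Sg) hOfut (hQA i) (hconv i) (Λt i) (ξ i) (T₀ i) (hΛt i) (hξ i) (hT₀c i) hclockd
      (hpos' i) hdecTilt (htop i) (hhon i) (fun t ↦ t) monotone_id tendsto_id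
    obtain ⟨S, hS⟩ := hreach 1 one_pos
    exact ⟨R, hRm, hRtop, hconvR, S, hS⟩
  choose R hRm hRtop hconvR Sr₀ hSr₀ using hreach0
  -- floor adjustment
  have hfl := fun i ↦ floor_profile (hRm i) (hRtop i) (Kerr.rPlus (M i) (a i) + 2)
  choose tfl htfl using fun i ↦ (hfl i).2.2.2
  set Rr : Fin N → ℝ → ℝ := fun i t ↦ max (R i t) (Kerr.rPlus (M i) (a i) + 2) with hRr
  set Sr : Fin N → ℝ := fun i ↦ max (Sr₀ i) (tfl i) with hSr
  have hrest : ∀ i (z : E4), (boostedKerrBackground 1 0 (M i) (a i)).time z = z 0 ∧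
      (boostedKerrBackground 1 0 (M i) (a i)).radius z = Kerr.radius (a i) z := fun i z ↦ by
    constructor
    · show (poincareInv 1 0 z) 0 = z 0; rw [Literature.Geometry.Lorentzian.poincareInv_one_zero]
    · show Kerr.radius (a i) (poincareInv 1 0 z) = _; rw [Literature.Geometry.Lorentzian.poincareInv_one_zero]
  refine ⟨Λt, T₀, C, A, hAU, θ, Rr, Sr, hΛt, he₀, hdec, hbil, hrad, hT₀c, hclock, hT₀lo, hT₀hi, htop, hAC, hAc,
    hAemb, hlate, hwin, hCle, hC0, hoff, hradii, hhon, hconv, fun i ↦ (hθ i).1, fun i ↦ (hθ i).2.1,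
    fun i ↦ (hθ i).2.2.1, fun i ↦ (hθ i).2.2.2.1, fun i ↦ (hθ i).2.2.2.2.1, fun i ↦ (hθ i).2.2.2.2.2.1,
    fun i ↦ (hθ i).2.2.2.2.2.2, fun i ↦ (hfl i).1, fun i ↦ (hfl i).2.1, fun i ↦ (hfl i).2.2.1,
    fun i ↦ ?_, fun i z τ₁ hz1 hz2 hr1 hr2 ↦ ?_⟩
  · -- convergence along the adjusted profile (eventually equal to `R i`)
    refine (hconvR i).congr' ?_
    filter_upwards [eventually_ge_atTop (tfl i)] with τ hτ
    show _ = 𝓢.truncDeviationCk _ _ 2 (max (R i τ) (Kerr.rPlus (M i) (a i) + 2)) τ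
    rw [htfl i τ hτ]
  · -- the reach along the adjusted profile
    have hzt : tfl i ≤ z.1 0 := (le_max_right _ _).trans hz1
    have hzS : Sr₀ i ≤ z.1 0 := (le_max_left _ _).trans hz1
    have hR1 : Rr i (z.1 0) = R i (z.1 0) := htfl i _ hzt
    have hR2 : Rr i τ₁ = R i τ₁ := htfl i _ (hzt.trans hz2)
    rw [hR2]
    rw [hR1] at hr2
    have h := hSr₀ i z τ₁ (by rw [(hrest i z.1).1]; exact hzS) (by rw [(hrest i z.1).1]; exact hz2)
      (by rw [(hrest i z.1).2]; exact hr1) (by rw [(hrest i z.1).1, (hrest i z.1).2]; exact hr2)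
    exact h

/-- Registered one-line form (stub `floor_profile_rechart` of the crux item) of `floor_profile`. [folklore] -/
theorem floor_profile_rechart : open Filter in ∀ {R : ℝ → ℝ}, Monotone R → Tendsto R atTop atTop → ∀ c : ℝ, Monotone (fun t ↦ max (R t) c) ∧ Tendsto (fun t ↦ max (R t) c) atTop atTop ∧ (∀ t, c ≤ max (R t) c) ∧ ∃ t₀, ∀ t, t₀ ≤ t → max (R t) c = R t :=
  fun hRm hRtop c ↦ floor_profile hRm hRtop c

end Summit.FinalStateConjecture.FinalStateConjecture.Theorems
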